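import Mathlib.MeasureTheory.Integral.IntervalIntegral.Basic
import Literature.MathematicalPhysics.KineticTheory.HardSphereBBGKYLiouvilleFlow
import Literature.MathematicalPhysics.KineticTheory.HardSphereEuler
import HarnessLib

/-!
# Energy conservation prices quadratic-growth perturbations of a window functional (stub S5)

Helper file (`--supports stmt-AtomisticToContinuum-15145`) proving the registered stub
`stub_windowPerturbationLe` of the lead's skeleton for the crux
`Summit.AtomisticToContinuum.HydrodynamicLimit.Theses.TwoClocks.ClampedEntropyClock`
(line `IdeatorTwoSketch`, card renyi-open-condition): if two one-body functionals `F, F'` on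
`𝕋³ × ℝ³` differ by at most `η (1 + ‖v‖²)`, then under any local Gibbs law of `N + 1` hard spheres the
exponential moment of `β` times the window average `Σ_i w⁻¹ ∫₀^w (F' − F)(z_i(r)) dr` along the
hard-sphere flow is dominated by the exponential moment of the STATIC quantity
`|β| η ((N+1) + 2·E(z))`, `E(z) = ½ Σ_i ‖v_i‖²` the kinetic energy.

Proof summary. (1) A.e. under the local Gibbs law (absolutely continuous w.r.t. the Liouville
measure, which is carried by the flow's good set) the initial datum is good, and along a good orbit
the kinetic energy is conserved (`HardSphereFlow.configEnergy_flow`). (2) Pathwise bound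
(`abs_sum_windowAvg_le`): summing the interval integrals only over the indices `i` whose integrand is
interval-integrable (the others contribute the junk value `0`), the sum of integrals is the integral
of the sum, whose integrand is bounded on the window by
`Σ_i η (1 + ‖v_i(r)‖²) = η ((N+1) + 2 E(Φ_r z)) = η ((N+1) + 2 E(z))`, a constant in `r`; so the window
average is at most that constant in absolute value (`intervalIntegral.norm_integral_le_of_norm_le_const`).
No measurability of the orbit in time is needed. (3) `β S ≤ |β| |S|`, monotonicity of `exp`, `ofReal`
and of the lower Lebesgue integral a.e. (`lintegral_mono_ae`).
-/

noncomputable section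

namespace Summit.AtomisticToContinuum.HydrodynamicLimit.Theorems.QuenchedCellClock

open MeasureTheory Set Filter
open scoped ENNReal Interval
open Literature.MathematicalPhysics.KineticTheory Literature.Analysis.FluidPDE

/-- **Window averages of dominated integrands, junk-value-robust.** For finitely many real functions
`g i` on a window `(0, w]`, `w > 0`, dominated there by non-negative `b i` whose sum is at most `C`
pointwise, the sum of the window averages `Σ_i w⁻¹ ∫₀^w g i` is at most `C` in absolute value — with
Mathlib's interval integral (junk value `0` for a non-interval-integrable `g i`, which is harmless: such
an index contributes `0` and its `b i ≥ 0` only enlarges the bound). No measurability or integrability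
hypothesis. [folklore] -/
theorem abs_sum_windowAvg_le {ι : Type*} (s : Finset ι) (g b : ι → ℝ → ℝ) {w C : ℝ} (hw : 0 < w)
    (hgb : ∀ i ∈ s, ∀ r ∈ Ι (0 : ℝ) w, |g i r| ≤ b i r)
    (hb : ∀ i ∈ s, ∀ r ∈ Ι (0 : ℝ) w, 0 ≤ b i r)
    (hsum : ∀ r ∈ Ι (0 : ℝ) w, ∑ i ∈ s, b i r ≤ C) :
    |∑ i ∈ s, w⁻¹ * ∫ r in (0 : ℝ)..w, g i r| ≤ C := by
  classical
  -- the indices whose integrand is interval-integrable on the window; the others integrate to `0`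
  let I : Finset ι := s.filter (fun i => IntervalIntegrable (g i) volume 0 w)
  have hI : ∀ i ∈ I, IntervalIntegrable (g i) volume 0 w := fun i hi => (Finset.mem_filter.1 hi).2
  have h1 : ∑ i ∈ s, w⁻¹ * ∫ r in (0 : ℝ)..w, g i r = w⁻¹ * ∫ r in (0 : ℝ)..w, ∑ i ∈ I, g i r := by
    rw [intervalIntegral.integral_finsetSum hI, Finset.mul_sum, Finset.sum_filter]
    refine Finset.sum_congr rfl (fun i _ => ?_)
    split_ifs with h
    · rfl
    · rw [intervalIntegral.integral_undef h, mul_zero]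
  have h2 : ‖∫ r in (0 : ℝ)..w, ∑ i ∈ I, g i r‖ ≤ C * |w - 0| := by
    refine intervalIntegral.norm_integral_le_of_norm_le_const (fun r hr => ?_)
    rw [Real.norm_eq_abs]
    calc |∑ i ∈ I, g i r| ≤ ∑ i ∈ I, |g i r| := Finset.abs_sum_le_sum_abs _ _
      _ ≤ ∑ i ∈ I, b i r := Finset.sum_le_sum (fun i hi => hgb i (Finset.mem_filter.1 hi).1 r hr)
      _ ≤ ∑ i ∈ s, b i r :=
          Finset.sum_le_sum_of_subset_of_nonneg (Finset.filter_subset _ _) (fun i hi _ => hb i hi r hr)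
      _ ≤ C := hsum r hr
  rw [sub_zero, abs_of_pos hw, Real.norm_eq_abs] at h2
  rw [h1, abs_mul, abs_of_pos (inv_pos.2 hw)]
  calc w⁻¹ * |∫ r in (0 : ℝ)..w, ∑ i ∈ I, g i r| ≤ w⁻¹ * (C * w) :=
        mul_le_mul_of_nonneg_left h2 (inv_pos.2 hw).le
    _ = C := by field_simp

/-- **Pathwise window-perturbation bound from energy conservation.** On the good set of a hard-sphere
flow of `N + 1` spheres, if `|F' y − F y| ≤ η (1 + ‖y.2‖²)` then for every window `(0, w]`, `w > 0`,
`|Σ_i w⁻¹ ∫₀^w (F' − F)(Φ_r z i) dr| ≤ η ((N+1) + 2 E(z))`: pointwise in `r`,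
`Σ_i η (1 + ‖v_i(r)‖²) = η ((N+1) + 2 E(Φ_r z))` and `E(Φ_r z) = E(z)`
(`HardSphereFlow.configEnergy_flow`). [folklore] -/
theorem abs_sum_windowAvg_flow_le (σ : ℝ) (N : ℕ)
    (Φ : HardSphereFlow (Torus.geometry (Fin 3)) (hsDiameter σ N) (N + 1))
    (F F' : T3 × V3 → ℝ) {η : ℝ} (hη : 0 ≤ η) (hFF' : ∀ y, |F' y - F y| ≤ η * (1 + ‖y.2‖ ^ 2))
    {w : ℝ} (hw : 0 < w) {z : Config (N + 1) (Fin 3) T3} (hz : z ∈ Φ.good) :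
    |∑ i : Fin (N + 1), w⁻¹ * ∫ r in (0 : ℝ)..w, (F' ((Φ.flow r z) i) - F ((Φ.flow r z) i))|
      ≤ η * (((N : ℝ) + 1) + 2 * configEnergy z) := by
  refine abs_sum_windowAvg_le Finset.univ (fun i r => F' ((Φ.flow r z) i) - F ((Φ.flow r z) i))
    (fun i r => η * (1 + ‖((Φ.flow r z) i).2‖ ^ 2)) hw (fun i _ r _ => hFF' _)
    (fun i _ r _ => by positivity) (fun r _ => le_of_eq ?_)
  rw [← Φ.configEnergy_flow hz r, configEnergy, ← Finset.mul_sum, Finset.sum_add_distrib]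
  simp only [Finset.sum_const, Finset.card_univ, Fintype.card_fin, nsmul_eq_mul, mul_one]
  push_cast
  ring

/-- **Stub S5 — energy conservation prices quadratic-growth perturbations of a window functional.** If
`|F' y − F y| ≤ η (1 + ‖y.2‖²)` then, almost surely under any local Gibbs law (the flow's good set is conull
and kinetic energy is conserved along every good orbit), the window average of `Σ_i (F' − F)` over ANY window
`(0, w]` is bounded by `η ((N+1) + 2·configEnergy z)` — a STATIC quantity — so its exponential moment is
dominated by that of the static bound. [folklore] -/
theorem stub_windowPerturbationLe (σ : ℝ) (a θ : T3 → ℝ) (u : T3 → V3) (N : ℕ)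
    (Φ : HardSphereFlow (Torus.geometry (Fin 3)) (hsDiameter σ N) (N + 1))
    (F F' : T3 × V3 → ℝ) {η : ℝ} (hη : 0 ≤ η) (hFF' : ∀ y, |F' y - F y| ≤ η * (1 + ‖y.2‖ ^ 2))
    (β : ℝ) {w : ℝ} (hw : 0 < w) :
    ∫⁻ z, ENNReal.ofReal (Real.exp (β * ∑ i : Fin (N + 1),
        w⁻¹ * ∫ r in (0 : ℝ)..w, (F' ((Φ.flow r z) i) - F ((Φ.flow r z) i))))
      ∂(localGibbsLaw σ a u θ N Φ) ≤
    ∫⁻ z, ENNReal.ofReal (Real.exp (|β| * η * (((N : ℝ) + 1) + 2 * configEnergy z)))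
      ∂(localGibbsLaw σ a u θ N Φ) := by
  have hac : localGibbsLaw σ a u θ N Φ ≪
      liouville (Torus.geometry (Fin 3)) (N + 1) (hsDiameter σ N) := by
    rw [localGibbsLaw, particleLaw_eq]; exact withDensity_absolutelyContinuous _ _
  refine lintegral_mono_ae ?_
  filter_upwards [hac.ae_le Φ.ae_mem_good] with z hz
  refine ENNReal.ofReal_le_ofReal (Real.exp_le_exp.2 ?_)
  have hS := abs_sum_windowAvg_flow_le σ N Φ F F' hη hFF' hw hz
  calc β * ∑ i : Fin (N + 1), w⁻¹ * ∫ r in (0 : ℝ)..w, (F' ((Φ.flow r z) i) - F ((Φ.flow r z) i))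
      ≤ |β * ∑ i : Fin (N + 1), w⁻¹ * ∫ r in (0 : ℝ)..w, (F' ((Φ.flow r z) i) - F ((Φ.flow r z) i))| :=
        le_abs_self _
    _ ≤ |β| * (η * (((N : ℝ) + 1) + 2 * configEnergy z)) := by
        rw [abs_mul]; exact mul_le_mul_of_nonneg_left hS (abs_nonneg β)
    _ = |β| * η * (((N : ℝ) + 1) + 2 * configEnergy z) := by ring

end Summit.AtomisticToContinuum.HydrodynamicLimit.Theorems.QuenchedCellClock

end
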